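import Summits.ValiantsHypothesis.ValiantsHypothesis.Theorems.SymPencilSdcPerThreeTen

/-!
# Route `SymPencil`: the `n = 4` instances of the cruxes `SdcPerSq` (stmt-ValiantsHypothesis-5675)
# and `SdcPerBeyondN` (stmt-ValiantsHypothesis-5676) — `sdc(per_4) ≥ 17`

PARTIAL-RANGE result (honest range: `n = 4` only; `n = 3` is the tree's
`SymPencilSdcPerThreeTen.thirteen_le_of_isSymm_isAffineDetRepr_perPoly_three`; the cruxes themselves
quantify over all `n ≥ 3` and stay OPEN for `n ≥ 5`, where the symmetric Alper–Bogart–Velasco bound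
`4 n + 1` used here falls below `n²`).

Every SYMMETRIC affine determinantal representation of `per_4` over a field with `2 ≠ 0` has size
`≥ 17 = 4² + 1`: the symmetric ABV inequality `2 n² + 1 ≤ 2 dim W + m` of the tree
(`SymPencilSdcPerThreeTen.exists_subspace_of_isSymm_isAffineDetRepr_perPoly`: total isotropy of the
Gauss image for the diagonal form of the congruence normal form) with `W` a linear space of `4 × 4`
matrices on which all sixteen `3 × 3` subpermanents vanish, and the tree's
`AlperBogartVelasco.finrank_le_eight_of_subperm_three_vanish` (`dim W ≤ 8`), give `33 ≤ 16 + m`.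
This is the `n = 4` case announced ("filed separately") in the header of
`Theorems/SymPencilSdcPerThreeTen.lean`; non-symmetric analogue: `dc(per_4) ≥ 9`
(`AlperBogartVelasco.nine_le_determinantalComplexity_perPoly_four`).

HONEST FRAMING: a finite calibration point (`n = 4`) of two open cruxes; no bearing on `VP ≠ VNP`.
-/

noncomputable section

-- single-conjunct layout: Sub = Summit, duplicated namespace component intended
set_option linter.dupNamespace false

namespace Summit.ValiantsHypothesis.ValiantsHypothesis.Theorems.SymPencilSdcPerFour

open Matrix MvPolynomial Module
open Literature.Computability.AlgebraicComplexity
open Literature.Computability.AlgebraicComplexity.AlperBogartVelasco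
open Summit.ValiantsHypothesis.ValiantsHypothesis.Theorems.SymPencilSdcPerThreeTen

/-- **`sdc(per_4) ≥ 17`** over any field with `2 ≠ 0`: a symmetric affine determinantal
representation of `per_4` of size `n` gives `W` with `33 ≤ 2 dim W + n`
(`exists_subspace_of_isSymm_isAffineDetRepr_perPoly`) and `dim W ≤ 8`
(`finrank_le_eight_of_subperm_three_vanish`). -/
theorem seventeen_le_of_isSymm_isAffineDetRepr_perPoly_four (K : Type*) [Field K]
    (h2 : (2 : K) ≠ 0) {n : ℕ} {A : Matrix (Fin n) (Fin n) (MvPolynomial (Fin 4 × Fin 4) K)}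
    (hS : A.IsSymm) (hA : IsAffineDetRepr (perPoly (Fin 4) K) A) : 17 ≤ n := by
  obtain ⟨W, hW, hvan⟩ := exists_subspace_of_isSymm_isAffineDetRepr_perPoly h2 (by norm_num) hS hA
  have hfin : finrank K W ≤ 8 :=
    finrank_le_eight_of_subperm_three_vanish W fun x hx r c => by
      rw [← eval_pderiv_perPoly_eq_permanent_submatrix]
      exact hvan x hx (r, c)
  omega

/-- **The `n = 4` instance of the crux `SdcPerBeyondN` (stmt-ValiantsHypothesis-5676)**: every
symmetric affine determinantal representation of `per_4` over `ℂ` has size `≥ 4² + 1`.  The crux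
(all `n ≥ 3`) remains open for `n ≥ 5`. -/
theorem sdcPerBeyondN_four (m : ℕ) (A : Matrix (Fin m) (Fin m) (MvPolynomial (Fin 4 × Fin 4) ℂ))
    (hS : A.IsSymm) (hA : IsAffineDetRepr (perPoly (Fin 4) ℂ) A) : 4 ^ 2 + 1 ≤ m := by
  have h := seventeen_le_of_isSymm_isAffineDetRepr_perPoly_four ℂ two_ne_zero hS hA
  omega

/-- **The `n = 4` instance of the crux `SdcPerSq` (stmt-ValiantsHypothesis-5675)**: every symmetric
affine determinantal representation of `per_4` over `ℂ` has size `≥ 4²`.  The crux (all `n ≥ 3`)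
remains open for `n ≥ 5`. -/
theorem sdcPerSq_four (m : ℕ) (A : Matrix (Fin m) (Fin m) (MvPolynomial (Fin 4 × Fin 4) ℂ))
    (hS : A.IsSymm) (hA : IsAffineDetRepr (perPoly (Fin 4) ℂ) A) : 4 ^ 2 ≤ m := by
  have h := seventeen_le_of_isSymm_isAffineDetRepr_perPoly_four ℂ two_ne_zero hS hA
  omega

/-- The cruxes `SdcPerSq` and `SdcPerBeyondN` restricted to the range `3 ≤ n ≤ 4` (the honest
partial range settled in the tree: `n = 3` by `thirteen_le_of_isSymm_isAffineDetRepr_perPoly_three`,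
`n = 4` by `seventeen_le_of_isSymm_isAffineDetRepr_perPoly_four`). -/
theorem sdcPerBeyondN_of_le_four (n : ℕ) (h3 : 3 ≤ n) (h4 : n ≤ 4) (m : ℕ)
    (A : Matrix (Fin m) (Fin m) (MvPolynomial (Fin n × Fin n) ℂ)) (hS : A.IsSymm)
    (hA : IsAffineDetRepr (perPoly (Fin n) ℂ) A) : n ^ 2 + 1 ≤ m := by
  interval_cases n
  · have h := thirteen_le_of_isSymm_isAffineDetRepr_perPoly_three ℂ two_ne_zero hS hA
    omega
  · have h := seventeen_le_of_isSymm_isAffineDetRepr_perPoly_four ℂ two_ne_zero hS hA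
    omega

end Summit.ValiantsHypothesis.ValiantsHypothesis.Theorems.SymPencilSdcPerFour

end
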